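import Summits.NavierStokesRegularity.NavierStokesRegularity.Theses.SqueezeCycle
import Literature.Analysis.FluidPDE.LocalTypeI

/-!
# Harvest signatures (strategist census §3 S3) — crux stmt-NavierStokesRegularity-1589 `RecurrentLiouville`

Typed forms of the Giga–Kohn-metric statements of STRATEGY-CENSUS.md §3 S3, checked for elaboration
only (no proofs here; planners do not prove):

* `gaussScalingAction u t₀ t₁` — the Gaussian scaling ACTION of a (smooth) field on the backward window
  `(t₀, t₁) ⊆ (-∞,0)`: `∫_{t₀}^{t₁} ∫_{ℝ³} ‖Z u‖² · heatKernel (−t) x dx dt` with the SCALING DEFECT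
  `Z u (t,x) = ½ u + ½ (x·∇) u + t ∂ₜ u` (`= d/dλ|_{λ=1} λ u(λx, λ²t)`); in Leray similarity variables it
  equals `(4π)^{-3/2} ∫ ‖∂ₛU‖²_{L²(e^{-|y|²/4})} ds` and vanishes exactly on self-similar windows.
* `StationaryWindowRemoval` — PROVABLE NOW (tree tools: `slab_typeI_compactness`, persistence,
  `tsai_selfsimilar_local_energy_holds`, bounded Oseen-mild uniqueness): a class member whose action on
  one unit similarity-window `(4t₀, t₀)` is `≤ η(C,M)` is regular at the origin.
* `NeverRests` — its portrait corollary: every Type-I singularity model spends action `≥ η` on EVERY unit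
  window ("a Type-I singularity never slows down in similarity variables").
* `BoundedScalingAction` — the quantitative strengthening BSA; census S3(b): BSA ⟺ crux by the
  compactness exchange, so it is NOT a line stub (costume), only the specification of what a
  monotonicity formula would have to deliver.
-/

noncomputable section

open MeasureTheory Set Function
open scoped ENNReal Topology
open Literature.Analysis.FluidPDE Literature.Analysis.UnboundedOperators

namespace Summit.NavierStokesRegularity.NavierStokesRegularity.Cruxes.RecurrentLiouville.Harvest

local notation "ℝ³" => EuclideanSpace ℝ (Fin 3)
local notation "𝕊" => Literature.Analysis.FluidPDE.slab (EuclideanSpace ℝ (Fin 3)) (Set.Iio (0 : ℝ)) isOpen_Iio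

/-- Scaling defect `Z u (t,x) = ½ u + ½ (x·∇)u + t ∂ₜu` of a space–time field (classical derivatives;
meaningful on the open slab for the smooth representative of a class member). -/
def scalingDefect (u : ℝ → ℝ³ → ℝ³) (t : ℝ) (x : ℝ³) : ℝ³ :=
  (2 : ℝ)⁻¹ • u t x + (2 : ℝ)⁻¹ • (fderiv ℝ (u t) x) x + t • deriv (fun τ => u τ x) t

/-- Gaussian scaling action on the backward window `(t₀, t₁)`:
`∫_{t₀}^{t₁} ∫ ‖Z u(t,x)‖² · heatKernel (−t) x dx dt` (scale-invariant; `= (4π)^{-3/2} ∫ ‖∂ₛU‖²_{L²(ρ)} ds`). -/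
def gaussScalingAction (u : ℝ → ℝ³ → ℝ³) (t₀ t₁ : ℝ) : ℝ :=
  ∫ t in Set.Ioo t₀ t₁, ∫ x, ‖scalingDefect u t x‖ ^ 2 * heatKernel (-t) x

/-- **StationaryWindowRemoval** (provable now): for every rate `C` and level `M < ⊤` there is `η > 0`
such that a smooth-on-the-open-slab suitable weak solution with `𝐈 ≤ M` and the rate, whose Gaussian
scaling action on SOME unit similarity-window `(4t₀, t₀)` is `≤ η`, is regular at the origin. -/
def StationaryWindowRemoval : Prop :=
  ∀ (C : ℝ) (M : ℝ≥0∞), M < ⊤ → ∃ η : ℝ, 0 < η ∧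
    ∀ (u : ℝ → ℝ³ → ℝ³) (p : ℝ → ℝ³ → ℝ) (G : ℝ → ℝ³ → ℝ³ →L[ℝ] ℝ³),
      IsSuitableWeakSolutionOn 𝕊 1 0 u p → HasWeakSpatialGradientOn 𝕊 u G →
      typeIBound (Set.Iio (0 : ℝ) ×ˢ Set.univ) u p G ≤ M → HasTypeITimeDecay C u →
      ContDiffOn ℝ (⊤ : ℕ∞) (uncurry u) (Set.Iio 0 ×ˢ Set.univ) →
      (∃ t₀ : ℝ, t₀ < 0 ∧ gaussScalingAction u (4 * t₀) t₀ ≤ η) →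
      ¬ IsBackwardSingularPoint u 0

/-- **NeverRests** (portrait corollary): every Type-I singularity model of the class (smooth
representative) spends Gaussian scaling action `≥ η(C,M)` on every unit similarity-window. -/
def NeverRests : Prop :=
  ∀ (C : ℝ) (M : ℝ≥0∞), M < ⊤ → ∃ η : ℝ, 0 < η ∧
    ∀ (u : ℝ → ℝ³ → ℝ³) (p : ℝ → ℝ³ → ℝ) (G : ℝ → ℝ³ → ℝ³ →L[ℝ] ℝ³),
      IsSuitableWeakSolutionOn 𝕊 1 0 u p → HasWeakSpatialGradientOn 𝕊 u G →
      typeIBound (Set.Iio (0 : ℝ) ×ˢ Set.univ) u p G ≤ M → HasTypeITimeDecay C u →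
      ContDiffOn ℝ (⊤ : ℕ∞) (uncurry u) (Set.Iio 0 ×ˢ Set.univ) →
      IsBackwardSingularPoint u 0 → ∀ t₀ : ℝ, t₀ < 0 → η ≤ gaussScalingAction u (4 * t₀) t₀

/-- The two statements are contrapositive forms of each other (pure logic). -/
theorem neverRests_iff_stationaryWindowRemoval : NeverRests ↔ StationaryWindowRemoval := by
  constructor
  · intro h C M hM
    obtain ⟨η, hη, H⟩ := h C M hM
    refine ⟨η / 2, by positivity, ?_⟩
    rintro u p G hsw hwg hI hdec hsm ⟨t₀, ht₀, hsmall⟩ hsing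
    have := H u p G hsw hwg hI hdec hsm hsing t₀ ht₀
    linarith
  · intro h C M hM
    obtain ⟨η, hη, H⟩ := h C M hM
    refine ⟨η, hη, ?_⟩
    intro u p G hsw hwg hI hdec hsm hsing t₀ ht₀
    by_contra hlt
    push Not at hlt
    exact H u p G hsw hwg hI hdec hsm ⟨t₀, ht₀, hlt.le⟩ hsing

/-- **BoundedScalingAction** (BSA, census S3): a uniform bound on the action of every FINITE-WINDOW
classical solution with the Type-I envelope (rate `C` for `u`, the KNSS gauge bound `C₁` for `∇u`) and
scale-invariant local energy `≤ M` on the window. Non-vacuous (the finite-window class is non-empty), but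
crux-EQUIVALENT by the compactness exchange (census S3(b)) — recorded, not filed. -/
def BoundedScalingAction : Prop :=
  ∀ (C C₁ : ℝ) (M : ℝ≥0∞), M < ⊤ → ∃ K : ℝ,
    ∀ (T : ℝ) (u : ℝ → ℝ³ → ℝ³) (p : ℝ → ℝ³ → ℝ), T < 0 →
      IsClassicalNSSolutionOn (Set.Ioo T 0) 1 0 u p →
      (∀ t ∈ Set.Ioo T 0, ∀ x, ‖u t x‖ ≤ C / Real.sqrt (-t) ∧ ‖fderiv ℝ (u t) x‖ ≤ C₁ / (-t)) →
      (∀ (x₀ : ℝ³) (t₀ r : ℝ), t₀ ≤ 0 → 0 < r → T ≤ t₀ - r ^ 2 →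
        r⁻¹ * ∫ t in Set.Ioo (t₀ - r ^ 2) t₀, ∫ x in Metric.ball x₀ r, ‖fderiv ℝ (u t) x‖ ^ 2 ≤ M.toReal) →
      ∀ t₀ t₁ : ℝ, T < t₀ → t₀ < t₁ → t₁ < 0 → gaussScalingAction u t₀ t₁ ≤ K

/-- Shape of the (rejected) line: BSA and StationaryWindowRemoval compose to the crux by pigeonholing
a long window into unit sub-windows — stated, not proved (the seat does not register this line: its
strong stub BSA is certified crux-equivalent, census §3 S3(b), §6). -/
def GigaKohnActionLineShape : Prop :=
  BoundedScalingAction → StationaryWindowRemoval →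
    Summit.NavierStokesRegularity.NavierStokesRegularity.Theses.SqueezeCycle.RecurrentLiouville

end Summit.NavierStokesRegularity.NavierStokesRegularity.Cruxes.RecurrentLiouville.Harvest

end
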